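import Summits.QuantumFields.BalabanUV.Beta.GAN24.TaylorMassVHPush
import Summits.QuantumFields.BalabanUV.Beta.GAN24.TaylorMassVHAn1At
import Literature.MathematicalPhysics.QuantumFieldTheory.Balaban1983to89.Beta.DecLiftAdjoint

/-!
# (ρV-a-sym) FOR an1's SYMMETRISED BORDER TABLE: `TaylorMassVH` §2–§3 + `TaylorMassVHPush` §3 for the UN-NEGATED lifted table `borderSum M (symVhSAt (toSite r) d Lc)` (twin of `TaylorMassVHSymAt`)

NOT IN PRINT — OUR BOOKKEEPING (road-P2 = `b2b-balaban-gan24-p2` gen 56, 2026-08-25; row G-an2-4 ∕ (CONV-C), the (α-0) chain at row D1's literal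
OF RECORD (III′) `JsB12CombShSym`; [folklore] composition BY NAME; 0 `def`, 0 cite, 0 `def … : Prop`, 0 `sorry`).  Weight 0.  NEVER «G-an2-4 closed» as (CONV-C);
NOT D1, NOT BetaPertH, NOT continuum, NOT Clay; NO campaign opened (an2 W-4) — a brick of the located `hUv⁰` transfer (road-P2 MEMO M-gan24p2-g56-1 §2(b) with M.77's
RAW-table socket `CombBornBorderLettersRaw`).

NAMING: in this package «Sym» in the ROOTED file names (`…SymAt`) means the UN-NEGATED rooted border `vhSAt ρ` (the OWNER's W15), while «An1» (these files) means an1's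
(0.4)-SYMMETRISED border table `SymAveragingHessianCounts.symVhSAt ρ` — the type of the record field `SymTables.V`.  METHOD = the OWNER gan24-p1's gen-6 `mkroot.py` rule
(road-P2's `tools/mkstab.py`): the ROOTED file VERBATIM with `vhSAt (toSite r) ↦ symVhSAt (toSite r)`, asym's `SpineRooted.borderIncAt ↦ TaylorMassVHAn1At.symBorderIncAt`, an1's
rooted support ∕ entry ∕ locality lemmas ↦ his SYMMETRISED ones (`symVhKerAt_eq_zero_left ∕ _right`, `abs_symVhKerAt_le ≤ 3ℓ²` «the SAME constant as the comb's», `locStencil_symVhSAt`,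
block accessors by `packVH`); every ROOT-FREE lemma of the base modules BY NAME (not re-declared); same theorem names in the `…An1At` namespaces; base and rooted modules untouched;
zero-root bridges dropped (no root-0 base twin for the sym table).  Discharges NOTHING of (hS, hSall) ∕ hB by itself.
-/

noncomputable section

open Finset
open scoped BigOperators
open Literature.MathematicalPhysics.QuantumFieldTheory
open Literature.MathematicalPhysics.QuantumFieldTheory.Balaban1983to89
open Literature.MathematicalPhysics.QuantumFieldTheory.Balaban1983to89.Beta
open Literature.Probability.LatticeModels (Torus.proj Torus.proj_apply)
open LatticeForm (quo)
open B12Sec2to5 (l1 l1_nonneg)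
open ExpKernelCalculus (MKer l1_natSmul l1_sub_triangle l1_sub_symm)
open OneStepResolventKernel (Fib)
open InterLevelTransport (avgLift)
open AffineAveraging (box toSite)
open AveragingHessianKernels (packVH packVH_inl_inr packVH_inr_inl packVH_inl_inl packVH_inr_inr Near ell near_self l1_le_of_near eq_smul_blk_of_off_eq_zero)
open Summit.QuantumFields.BalabanUV.Beta.SymAveragingHessianCounts (symVhSAt symVhKerAt symVhKerAt_eq_zero_left symVhKerAt_eq_zero_right abs_symVhKerAt_le
  locStencil_symVhSAt symVhSAt_symm)
open AveragingContours (blk off)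
open BalabanCompositeJets (bshift pushSum)
open OneStepResolventKernel (eq_zsmul_quo_of_proj)
open OneStepKernelFamily (legPt)
open Summit.QuantumFields.BalabanUV.Beta.GAN24.PushSumNest (pushSum_inr_of_proj_ne')
open Summit.QuantumFields.BalabanUV.Beta.GAN24.TaylorMassVHPush (sum_abs_pushSum_inl_inr_le sum_abs_pushSum_inr_inl_le pushSum_inl_inr_coarse_sum)
open DecLiftAdjoint (borderSum)
open Summit.QuantumFields.BalabanUV.Beta.GAN24.TaylorMassLam (exists_of_avgLift_ne_zero abs_avgLift_inl_inr_le abs_avgLift_inr_inl_le)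
open Summit.QuantumFields.BalabanUV.Beta.GAN24.TaylorMassVH (l1_sub_zsmul_le_of_chain avgLift_inr_right_ne_zero_proj avgLift_inr_left_ne_zero_proj
  l1_sub_zsmul_quo_bshift_le card_filter_coarse_l1_le)
open Summit.QuantumFields.BalabanUV.Beta.GAN24.TaylorMassVHAn1At (abs_vhSAt_le vhSAt_ne_zero)

namespace Summit.QuantumFields.BalabanUV.Beta.GAN24.TaylorMassVHSymAn1At

variable {d : ℕ}

/-! ## §2-σ The lifted rooted (V-H) table -/

section Lift

variable {Lc : ℕ} {r : Fin (d + 1) → ℕ} (M : ℕ) [NeZero M]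

/-- [folklore] **SIZE OF THE LIFTED ROOTED (V-H) TABLE** (box root): `|avgLift M (symVhSAt (toSite r) d Lc κ′ u′) x w a b| ≤ 3ℓ² ∕ M^{d+1}` (un-negated table) on every block. -/
theorem abs_avgLift_vhSAt_le (hL : 1 ≤ Lc) (hr : r ∈ box (d + 1) Lc) (κ' : Fin (d + 1)) (u' x w : Fin (d + 1) → ℤ) (a b : Fib d) :
    |avgLift M (symVhSAt (toSite r) d Lc rfl κ' u') x w a b| ≤ 3 * (ell (d + 1) Lc : ℝ) ^ 2 / (M : ℝ) ^ (d + 1) := by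
  have h0 : (0 : ℝ) ≤ 3 * (ell (d + 1) Lc : ℝ) ^ 2 / (M : ℝ) ^ (d + 1) := by positivity
  have hS : ∀ X Z (a b : Fib d), |symVhSAt (toSite r) d Lc rfl κ' u' X Z a b| ≤ 3 * (ell (d + 1) Lc : ℝ) ^ 2 := fun X Z a b =>
    abs_vhSAt_le hL hr κ' u' X Z a b
  rcases a with α | μ <;> rcases b with β | ν
  · have hz : avgLift M (symVhSAt (toSite r) d Lc rfl κ' u') x w (Sum.inl α) (Sum.inl β) = 0 := by
      by_contra hne
      obtain ⟨X, W, hG, -, -⟩ := exists_of_avgLift_ne_zero M _ hne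
      exact hG (packVH_inl_inl _ Lc κ' u' X W α β)
    rw [hz, abs_zero]; exact h0
  · exact abs_avgLift_inl_inr_le M _ α ν (fun X W => hS X W _ _) x w
  · exact abs_avgLift_inr_inl_le M _ μ β (fun X W => hS X W _ _) x w
  · have hz : avgLift M (symVhSAt (toSite r) d Lc rfl κ' u') x w (Sum.inr μ) (Sum.inr ν) = 0 := by
      by_contra hne
      obtain ⟨X, W, hG, -, -⟩ := exists_of_avgLift_ne_zero M _ hne
      exact hG (packVH_inr_inr _ Lc κ' u' X W μ ν)
    rw [hz, abs_zero]; exact h0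

/-- [folklore] **SUPPORT OF THE LIFTED ROOTED (V-H) TABLE** (box root): both fine legs of a nonzero entry lie within `ℓ¹`-distance `2(d+1)(Lc+1)·M` of `M•u′`. -/
theorem avgLift_vhSAt_ne_zero (hL : 1 ≤ Lc) (hr : r ∈ box (d + 1) Lc) {κ' : Fin (d + 1)} {u' x w : Fin (d + 1) → ℤ} {a b : Fib d}
    (h : avgLift M (symVhSAt (toSite r) d Lc rfl κ' u') x w a b ≠ 0) :
    l1 (x - (M : ℤ) • u') ≤ 2 * ((d : ℝ) + 1) * (Lc + 1) * M ∧ l1 (w - (M : ℤ) • u') ≤ 2 * ((d : ℝ) + 1) * (Lc + 1) * M := by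
  obtain ⟨X, W, hG, hx, hw⟩ := exists_of_avgLift_ne_zero M _ h
  obtain ⟨hX, hW, -⟩ := vhSAt_ne_zero hL hr hG
  have e : ∀ {t : ℝ}, t ≤ 2 * (d + 1) * M + (M : ℝ) * (2 * ((d : ℝ) + 1) * Lc) → t ≤ 2 * ((d : ℝ) + 1) * (Lc + 1) * M :=
    fun ht => by linarith
  exact ⟨e (l1_sub_zsmul_le_of_chain M hx hX), e (l1_sub_zsmul_le_of_chain M hw hW)⟩

end Lift

/-! ## §3-σ The SYMMETRIC rooted border sum `borderSum M (fun κ z ↦ symVhSAt (toSite r) d Lc rfl κ z)` -/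

section Border

variable {Lc : ℕ} {r : Fin (d + 1) → ℕ} (M : ℕ) [NeZero M]

omit [NeZero M] in
/-- [folklore] The rooted border increment, entrywise, is the `borderInc`-shaped formula with the SYMMETRIC rooted table (definitional unfolding of `DecLiftAdjoint.borderSum`). -/
theorem borderSumV_apply (ρ : Fin (d + 1) → ℤ) (κ : Fin (d + 1)) (u x w : Fin (d + 1) → ℤ) (a b : Fib d) :
    borderSum M (fun κ₀ z₀ => symVhSAt ρ d Lc rfl κ₀ z₀) κ u x w a b = ∑ s ∈ Finset.range M, avgLift M (symVhSAt ρ d Lc rfl κ (quo M (u - bshift d κ s))) x w a b := rfl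

/-- [folklore] **SIZE OF THE ROOTED BORDER INCREMENT** (box root): `|borderSum M (fun κ₀ z₀ => symVhSAt (toSite r) d Lc rfl κ₀ z₀) κ u x w a b| ≤ M·(3ℓ² ∕ M^{d+1})`. -/
theorem abs_borderSumV_le (hL : 1 ≤ Lc) (hr : r ∈ box (d + 1) Lc) (κ : Fin (d + 1)) (u x w : Fin (d + 1) → ℤ) (a b : Fib d) :
    |borderSum M (fun κ₀ z₀ => symVhSAt (toSite r) d Lc rfl κ₀ z₀) κ u x w a b| ≤ (M : ℝ) * (3 * (ell (d + 1) Lc : ℝ) ^ 2 / (M : ℝ) ^ (d + 1)) := by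
  rw [borderSumV_apply]
  refine (Finset.abs_sum_le_sum_abs _ _).trans ?_
  refine (Finset.sum_le_sum fun s _ => abs_avgLift_vhSAt_le M hL hr κ _ x w a b).trans ?_
  rw [Finset.sum_const, Finset.card_range, nsmul_eq_mul]

/-- [folklore] **SUPPORT OF THE ROOTED BORDER INCREMENT** (box root): both legs of a nonzero entry lie within `ℓ¹`-distance `(2(d+1)(Lc+1) + 2d + 3)·M` of the fine bond `u`. -/
theorem borderSumV_ne_zero (hL : 1 ≤ Lc) (hr : r ∈ box (d + 1) Lc) {κ : Fin (d + 1)} {u x w : Fin (d + 1) → ℤ} {a b : Fib d}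
    (h : borderSum M (fun κ₀ z₀ => symVhSAt (toSite r) d Lc rfl κ₀ z₀) κ u x w a b ≠ 0) :
    l1 (x - u) ≤ ((2 * (d + 1) * (Lc + 1) + (2 * d + 3)) * M : ℕ) ∧ l1 (w - u) ≤ ((2 * (d + 1) * (Lc + 1) + (2 * d + 3)) * M : ℕ) := by
  rw [borderSumV_apply] at h
  obtain ⟨s, hs, hne⟩ := Finset.exists_ne_zero_of_sum_ne_zero h
  rw [Finset.mem_range] at hs
  obtain ⟨hx, hw⟩ := avgLift_vhSAt_ne_zero M hL hr hne
  have hu := l1_sub_zsmul_quo_bshift_le M κ u hs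
  have hu' : l1 ((M : ℤ) • quo M (u - bshift d κ s) - u) ≤ (2 * (d : ℝ) + 3) * M := by rw [l1_sub_symm]; exact hu
  have cast : (((2 * (d + 1) * (Lc + 1) + (2 * d + 3)) * M : ℕ) : ℝ) = 2 * ((d : ℝ) + 1) * (Lc + 1) * M + (2 * (d : ℝ) + 3) * M := by
    push_cast; ring
  rw [cast]
  constructor
  · have tri := l1_sub_triangle x ((M : ℤ) • quo M (u - bshift d κ s)) u
    linarith
  · have tri := l1_sub_triangle w ((M : ℤ) • quo M (u - bshift d κ s)) u
    linarith

omit [NeZero M] in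
/-- [folklore] The multiplier leg of the rooted border increment sits on the `M`-coarse lattice (second leg; any root). -/
theorem borderSumV_inr_right_ne_zero_proj (ρ : Fin (d + 1) → ℤ) {κ : Fin (d + 1)} {u x w : Fin (d + 1) → ℤ} {a : Fib d} {μ : Fin (d + 1)}
    (h : borderSum M (fun κ₀ z₀ => symVhSAt ρ d Lc rfl κ₀ z₀) κ u x w a (Sum.inr μ) ≠ 0) : Torus.proj M w = 0 := by
  rw [borderSumV_apply] at h
  obtain ⟨s, -, hne⟩ := Finset.exists_ne_zero_of_sum_ne_zero h
  exact avgLift_inr_right_ne_zero_proj M _ hne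

omit [NeZero M] in
/-- [folklore] The multiplier leg of the rooted border increment sits on the `M`-coarse lattice (first leg; any root). -/
theorem borderSumV_inr_left_ne_zero_proj (ρ : Fin (d + 1) → ℤ) {κ : Fin (d + 1)} {u x w : Fin (d + 1) → ℤ} {μ : Fin (d + 1)} {b : Fib d}
    (h : borderSum M (fun κ₀ z₀ => symVhSAt ρ d Lc rfl κ₀ z₀) κ u x w (Sum.inr μ) b ≠ 0) : Torus.proj M x = 0 := by
  rw [borderSumV_apply] at h
  obtain ⟨s, -, hne⟩ := Finset.exists_ne_zero_of_sum_ne_zero h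
  exact avgLift_inr_left_ne_zero_proj M _ hne

/-- [folklore] **MULTIPLIER-LEG MASS OF THE ROOTED BORDER INCREMENT AT A FIXED FIELD SITE** (box root; second leg): for every finite `T`,
`Σ_{w ∈ T} |borderSum M (fun κ₀ z₀ => symVhSAt (toSite r) d Lc rfl κ₀ z₀) κ u x w (inl α) (inr μ)| ≤ (2R_V+1)^{d+1}·M·3ℓ² ∕ M^{d+1}`, `R_V = 2(d+1)(Lc+1) + 2d + 3` — the base constant. -/
theorem sum_abs_borderSumV_inl_inr_le (hL : 1 ≤ Lc) (hr : r ∈ box (d + 1) Lc) (κ : Fin (d + 1)) (u x : Fin (d + 1) → ℤ) (α μ : Fin (d + 1))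
    (T : Finset (Fin (d + 1) → ℤ)) :
    ∑ w ∈ T, |borderSum M (fun κ₀ z₀ => symVhSAt (toSite r) d Lc rfl κ₀ z₀) κ u x w (Sum.inl α) (Sum.inr μ)| ≤
      ((2 * (2 * (d + 1) * (Lc + 1) + (2 * d + 3)) + 1) ^ (d + 1) : ℕ) * ((M : ℝ) * (3 * (ell (d + 1) Lc : ℝ) ^ 2 / (M : ℝ) ^ (d + 1))) := by
  classical
  set R : ℕ := 2 * (d + 1) * (Lc + 1) + (2 * d + 3) with hR
  set T' := T.filter fun w => Torus.proj M w = 0 ∧ l1 (w - u) ≤ ((R * M : ℕ) : ℝ) with hT'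
  have hsub : T' ⊆ T := Finset.filter_subset _ _
  have hvan : ∀ w ∈ T, w ∉ T' → |borderSum M (fun κ₀ z₀ => symVhSAt (toSite r) d Lc rfl κ₀ z₀) κ u x w (Sum.inl α) (Sum.inr μ)| = 0 := by
    intro w hw hw'
    rw [abs_eq_zero]
    by_contra hne
    exact hw' (Finset.mem_filter.2 ⟨hw, borderSumV_inr_right_ne_zero_proj M (toSite r) hne, (borderSumV_ne_zero M hL hr hne).2⟩)
  rw [← Finset.sum_subset hsub hvan]
  have hB : 0 ≤ (M : ℝ) * (3 * (ell (d + 1) Lc : ℝ) ^ 2 / (M : ℝ) ^ (d + 1)) := by positivity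
  calc ∑ w ∈ T', |borderSum M (fun κ₀ z₀ => symVhSAt (toSite r) d Lc rfl κ₀ z₀) κ u x w (Sum.inl α) (Sum.inr μ)|
      ≤ ∑ w ∈ T', (M : ℝ) * (3 * (ell (d + 1) Lc : ℝ) ^ 2 / (M : ℝ) ^ (d + 1)) :=
        Finset.sum_le_sum fun w _ => abs_borderSumV_le M hL hr κ u x w _ _
    _ = (T'.card : ℝ) * ((M : ℝ) * (3 * (ell (d + 1) Lc : ℝ) ^ 2 / (M : ℝ) ^ (d + 1))) := by rw [Finset.sum_const, nsmul_eq_mul]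
    _ ≤ _ := by
        refine mul_le_mul_of_nonneg_right ?_ hB
        exact_mod_cast card_filter_coarse_l1_le M T u R

/-- [folklore] The mirror block (box root): multiplier-leg mass at a fixed field site, summing over the FIRST leg. -/
theorem sum_abs_borderSumV_inr_inl_le (hL : 1 ≤ Lc) (hr : r ∈ box (d + 1) Lc) (κ : Fin (d + 1)) (u w : Fin (d + 1) → ℤ) (μ α : Fin (d + 1))
    (S : Finset (Fin (d + 1) → ℤ)) :
    ∑ x ∈ S, |borderSum M (fun κ₀ z₀ => symVhSAt (toSite r) d Lc rfl κ₀ z₀) κ u x w (Sum.inr μ) (Sum.inl α)| ≤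
      ((2 * (2 * (d + 1) * (Lc + 1) + (2 * d + 3)) + 1) ^ (d + 1) : ℕ) * ((M : ℝ) * (3 * (ell (d + 1) Lc : ℝ) ^ 2 / (M : ℝ) ^ (d + 1))) := by
  classical
  set R : ℕ := 2 * (d + 1) * (Lc + 1) + (2 * d + 3) with hR
  set S' := S.filter fun x => Torus.proj M x = 0 ∧ l1 (x - u) ≤ ((R * M : ℕ) : ℝ) with hS'
  have hsub : S' ⊆ S := Finset.filter_subset _ _
  have hvan : ∀ x ∈ S, x ∉ S' → |borderSum M (fun κ₀ z₀ => symVhSAt (toSite r) d Lc rfl κ₀ z₀) κ u x w (Sum.inr μ) (Sum.inl α)| = 0 := by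
    intro x hx hx'
    rw [abs_eq_zero]
    by_contra hne
    exact hx' (Finset.mem_filter.2 ⟨hx, borderSumV_inr_left_ne_zero_proj M (toSite r) hne, (borderSumV_ne_zero M hL hr hne).1⟩)
  rw [← Finset.sum_subset hsub hvan]
  have hB : 0 ≤ (M : ℝ) * (3 * (ell (d + 1) Lc : ℝ) ^ 2 / (M : ℝ) ^ (d + 1)) := by positivity
  calc ∑ x ∈ S', |borderSum M (fun κ₀ z₀ => symVhSAt (toSite r) d Lc rfl κ₀ z₀) κ u x w (Sum.inr μ) (Sum.inl α)|
      ≤ ∑ x ∈ S', (M : ℝ) * (3 * (ell (d + 1) Lc : ℝ) ^ 2 / (M : ℝ) ^ (d + 1)) :=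
        Finset.sum_le_sum fun x _ => abs_borderSumV_le M hL hr κ u x w _ _
    _ = (S'.card : ℝ) * ((M : ℝ) * (3 * (ell (d + 1) Lc : ℝ) ^ 2 / (M : ℝ) ^ (d + 1))) := by rw [Finset.sum_const, nsmul_eq_mul]
    _ ≤ _ := by
        refine mul_le_mul_of_nonneg_right ?_ hB
        exact_mod_cast card_filter_coarse_l1_le M S u R

end Border

/-! ## §4-σ The pushed rooted border increment (twin of `TaylorMassVHPush` §3; its §1–§2 are root-free — BY NAME) -/

section Pushed

variable {Lc : ℕ} {r : Fin (d + 1) → ℕ} (M L : ℕ) [NeZero M] [NeZero L] [NeZero Lc]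

/-- [folklore] **VH1-ρ, MASS — (field, multiplier) block** (box root): `Σ_{y ∈ T} |pushSum (M·Lc) L (borderSum M (fun κ₀ z₀ => symVhSAt ρ d Lc rfl κ₀ z₀) κ u) x y (inl α) (inr μ)| ≤ L·(2R_V+1)^{d+1}·(M·3ℓ²∕M^{d+1})`. -/
theorem sum_abs_pushSum_borderSumV_inl_inr_le (hL : 1 ≤ Lc) (hr : r ∈ box (d + 1) Lc) (κ : Fin (d + 1)) (u x : Fin (d + 1) → ℤ) (α μ : Fin (d + 1))
    (T : Finset (Fin (d + 1) → ℤ)) :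
    ∑ y ∈ T, |pushSum (M * Lc) L (borderSum M (fun κ₀ z₀ => symVhSAt (toSite r) d Lc rfl κ₀ z₀) κ u) x y (Sum.inl α) (Sum.inr μ)| ≤
      (L : ℝ) * (((2 * (2 * (d + 1) * (Lc + 1) + (2 * d + 3)) + 1) ^ (d + 1) : ℕ) *
        ((M : ℝ) * (3 * (ell (d + 1) Lc : ℝ) ^ 2 / (M : ℝ) ^ (d + 1)))) :=
  sum_abs_pushSum_inl_inr_le (M * Lc) L _ x α μ (fun Z => sum_abs_borderSumV_inl_inr_le M hL hr κ u x α μ Z) T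

/-- [folklore] **VH1-ρ, MASS — (multiplier, field) block** (box root; sum over the first leg at a fixed field site `w`). -/
theorem sum_abs_pushSum_borderSumV_inr_inl_le (hL : 1 ≤ Lc) (hr : r ∈ box (d + 1) Lc) (κ : Fin (d + 1)) (u w : Fin (d + 1) → ℤ) (μ α : Fin (d + 1))
    (S : Finset (Fin (d + 1) → ℤ)) :
    ∑ x ∈ S, |pushSum (M * Lc) L (borderSum M (fun κ₀ z₀ => symVhSAt (toSite r) d Lc rfl κ₀ z₀) κ u) x w (Sum.inr μ) (Sum.inl α)| ≤
      (L : ℝ) * (((2 * (2 * (d + 1) * (Lc + 1) + (2 * d + 3)) + 1) ^ (d + 1) : ℕ) *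
        ((M : ℝ) * (3 * (ell (d + 1) Lc : ℝ) ^ 2 / (M : ℝ) ^ (d + 1)))) :=
  sum_abs_pushSum_inr_inl_le (M * Lc) L _ w μ α (fun Z => sum_abs_borderSumV_inr_inl_le M hL hr κ u w μ α Z) S

/-- [folklore] **VH1-ρ, SUPPORT OF THE PUSHED ROOTED INCREMENT, (field, multiplier) block** (box root): a nonzero entry has its field leg within `R_V·M` of `u` and its
multiplier leg (a point of the new coarse lattice `(M·Lc·L)•ℤ^{d+1}`) within `R_V·M + 2(d+1)·(M·Lc)·L` of `u`. -/
theorem pushSum_borderSumV_inl_inr_ne_zero (hL : 1 ≤ Lc) (hr : r ∈ box (d + 1) Lc) {κ : Fin (d + 1)} {u x y : Fin (d + 1) → ℤ} {α μ : Fin (d + 1)}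
    (h : pushSum (M * Lc) L (borderSum M (fun κ₀ z₀ => symVhSAt (toSite r) d Lc rfl κ₀ z₀) κ u) x y (Sum.inl α) (Sum.inr μ) ≠ 0) :
    Torus.proj (M * Lc * L) y = 0 ∧ l1 (x - u) ≤ ((2 * (d + 1) * (Lc + 1) + (2 * d + 3)) * M : ℕ) ∧
      l1 (y - u) ≤ ((2 * (d + 1) * (Lc + 1) + (2 * d + 3)) * M : ℕ) + 2 * ((d : ℝ) + 1) * L * (M * Lc : ℕ) := by
  have hproj : Torus.proj (M * Lc * L) y = 0 := by
    by_contra hne; exact h (pushSum_inr_of_proj_ne' (M * Lc) L hne _ x _ μ)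
  refine ⟨hproj, ?_⟩
  have ey := eq_zsmul_quo_of_proj (N := M * Lc * L) hproj
  rw [ey, pushSum_inl_inr_coarse_sum] at h
  obtain ⟨i', hi', hne⟩ := Finset.exists_ne_zero_of_sum_ne_zero h
  obtain ⟨hx, hz⟩ := borderSumV_ne_zero M hL hr hne
  refine ⟨hx, ?_⟩
  set W' := quo (M * Lc * L) y with hW'
  have hoff : l1 (legPt L (Sum.inl μ : Fib d) W' i' - (L : ℤ) • W') ≤ 2 * (d + 1) * L :=
    OneStepKernelFamily.l1_legPt_sub_le L (Sum.inl μ : Fib d) W' hi'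
  have e1 : (((M * Lc * L : ℕ) : ℤ)) • W' = ((M * Lc : ℕ) : ℤ) • ((L : ℤ) • W') := by rw [smul_smul]; push_cast; ring_nf
  have hdist : l1 ((((M * Lc * L : ℕ) : ℤ)) • W' - ((M * Lc : ℕ) : ℤ) • legPt L (Sum.inl μ : Fib d) W' i') ≤ 2 * ((d : ℝ) + 1) * L * (M * Lc : ℕ) := by
    rw [e1, ← smul_sub, l1_natSmul, l1_sub_symm]
    have hMLc : (0 : ℝ) ≤ (M * Lc : ℕ) := Nat.cast_nonneg _
    calc ((M * Lc : ℕ) : ℝ) * l1 (legPt L (Sum.inl μ : Fib d) W' i' - (L : ℤ) • W') ≤ ((M * Lc : ℕ) : ℝ) * (2 * (d + 1) * L) :=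
          mul_le_mul_of_nonneg_left hoff hMLc
      _ = 2 * ((d : ℝ) + 1) * L * (M * Lc : ℕ) := by ring
  rw [← ey] at hdist
  have tri := l1_sub_triangle y (((M * Lc : ℕ) : ℤ) • legPt L (Sum.inl μ : Fib d) W' i') u
  linarith

end Pushed

end Summit.QuantumFields.BalabanUV.Beta.GAN24.TaylorMassVHSymAn1At

end
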